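import Summits.MatrixMultiplication.MatrixMultiplication.Theorems.AbelianSTPPCensusTB4StatDefs

/-!
# T_B static certificate, range `5591 … 5994` (t*-indexed linear checker with the k-member tree at `τ = 2375/1000`): kernel evaluation, the shape checks of the tree-heavy volumes `3468` on the order sub-range(s) `5591 … 5730`, `5731 … 5870`, `5871 … 5994` (one theorem per (volume, sub-range): bounded kernel memory)

Cell mm-stpp (rung F-M1), tier T_B = «beat `2.375` (Coppersmith–Winograd)»; checker in `AbelianSTPPCensusTB4StatDefs.lean`, table and bucket lists in `AbelianSTPPCensusTB4StatData.lean`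
(pattern: theory g12's `AbelianSTPPCensusTAStatDDom*/DCk*.lean`).  `decide` with kernel reduction (standard axioms; no `native_decide`), `Elab.async false`;
consumed by `TB4Stat.checkV_sound` / `TB4Stat.domV_sound` / `TB4Stat.m2V_sound` in the leaf `AbelianSTPPCensusLeafTB5994Closed.lean`.
WHAT THIS IS NOT: arithmetic on shape lists only; no statement about STPP families or `ω`.
-/

set_option linter.dupNamespace false
set_option autoImplicit false
set_option Elab.async false

namespace Summit.MatrixMultiplication.MatrixMultiplication.Theorems.TB4Stat

set_option maxHeartbeats 0 in
/-- Heavy volume `3468` (19 shapes; 32955 tree nodes over all orders), orders `5591 … 5730`: every sorted candidate shape passes `checkShape 5591 5730`. [original] -/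
theorem ck3468r0 : TB4Stat.checkV 5591 5730 1 3468 = true := by decide +kernel

set_option maxHeartbeats 0 in
/-- Heavy volume `3468` (19 shapes; 32955 tree nodes over all orders), orders `5731 … 5870`: every sorted candidate shape passes `checkShape 5731 5870`. [original] -/
theorem ck3468r1 : TB4Stat.checkV 5731 5870 1 3468 = true := by decide +kernel

set_option maxHeartbeats 0 in
/-- Heavy volume `3468` (19 shapes; 32955 tree nodes over all orders), orders `5871 … 5994`: every sorted candidate shape passes `checkShape 5871 5994`. [original] -/
theorem ck3468r2 : TB4Stat.checkV 5871 5994 1 3468 = true := by decide +kernel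

end Summit.MatrixMultiplication.MatrixMultiplication.Theorems.TB4Stat
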